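import Summits.CriticalPhenomena.PercolationContinuityZ3.Theorems.PercNearOneGluingAdditiveGluingGluingLemma5
import HarnessLib

/-! # Crux `PercNearOneGluing.AdditiveGluing` (stmt-CriticalPhenomena-4576), residual kernel — a QUANTITATIVE Kozma–Nitzan Lemma 5
# (invested seat xfam-a)

Support file (`--supports stmt-CriticalPhenomena-4576`; no definitions, no named facts).

Kozma–Nitzan's Lemma 5 compares, after gluing a block `S ∋ v`, a relay `a` with the block when `a` is at most as reliable as `v`
BEFORE gluing (`stub_gluingLemma5`).  In the residual kernel every block vertex is BAD (`μ_w(v ↔ b) < μ_w(a₀ ↔ b)`), so Lemma 5 is not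
available; this file proves the version with slack, keeping the sharp conditional factor of KN's Lemma 3(i) instead of its FKG bound:

* `knLemma3i_sharp`: if `μ(a₁↔b) ≤ μ(a₂↔b) + d` (`d ≥ 0`) and `Q` is increasing and determined by the open edge cluster of `a₂`, then with
  `N = {a₁ ↮ a₂}`:  `μ(N)·μ(a₁↔b, Q) ≤ μ(N)·μ(a₂↔b, Q) + d·μ(N ∩ Q)`  (the landed `knLemma3i` bounds `μ(N ∩ Q) ≤ μ(N)μ(Q)` by Harris).
* `gluingLemma5_quant` (**quantitative Lemma 5**): for `v ∈ S ∌ b`, ANY vertex `a`, `g = glue w S`: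
  `μ_w(a ↮ v) · μ_g(a ↔ b) ≤ μ_w(a ↮ v) · μ_g(v ↔ b) + (μ_w(a↔b) − μ_w(v↔b))⁺ · μ_g(a ↮ v)`,
  i.e. `μ_{w/S}(a↔b) ≤ μ_{w/S}(v↔b) + δ · μ_w(a ↮ S)/μ_w(a ↮ v)` with `δ` the badness gap of `v` below `a` (in `g`, `a ↮ v` iff `a ↮ S`).
  Proof = KN's (sprinkle the pairs inside `S`, Lemma 3(i) with `Q` = "all of them open", condition = glue, `ε → 0`) with the sharp lemma.
  Numerically (seat xfam-a, lab/exp7) the bound is attained.  It turns the block kernel into "pocket credit ≥ δ·μ(a₀↮S)/μ(a₀↮v)", a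
  sufficient condition that holds at the tightest known residual instance (the critic's HJ-attach witness) though not universally.
[cite: KozmaNitzan2024, §2.2 Lemma 3(i) (pp. 6–7), §3.2 Lemma 5 (p. 13)]
-/

namespace Summit.CriticalPhenomena.PercolationContinuityZ3.Theorems

open MeasureTheory Set
open Literature.Probability.LatticeModels (prodBernoulli)
open Literature.Probability.Percolation (BondConfig openConn openGraph)

noncomputable section
open Classical

section QuantLemma5

open Filter Topology
open Literature.Probability.LatticeModels Literature.Probability.Percolation

/-- **KN Lemma 3(i), sharp conditional form.**  If `μ(a₁↔b) ≤ μ(a₂↔b) + d` with `d ≥ 0` and `Q` is increasing and determined by the open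
edge cluster of `a₂`, then `μ(N)·μ(a₁↔b, Q) ≤ μ(N)·μ(a₂↔b, Q) + d·μ(N ∩ Q)`, `N = {a₁ ↮ a₂}`.  (BHK 2006 Thms 1.3/1.4 as in the landed
`knLemma3i`, without the final Harris step.) [cite: KozmaNitzan2024, Lemma 3(i) (pp. 6–7)] -/
theorem knLemma3i_sharp {n : ℕ} (w : Sym2 (Fin n) → unitInterval) (a₁ a₂ b : Fin n)
    (Q : Set (BondConfig (Fin n))) (d : ℝ)
    (hQ : ∀ ω ω', ω ∈ Q → openEdgeCluster ω a₂ ⊆ openEdgeCluster ω' a₂ → ω' ∈ Q)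
    (hd : 0 ≤ d)
    (hle : (prodBernoulli w).real (openConn a₁ b) ≤ (prodBernoulli w).real (openConn a₂ b) + d) :
    (prodBernoulli w).real (openConn a₁ a₂)ᶜ * (prodBernoulli w).real (openConn a₁ b ∩ Q) ≤
      (prodBernoulli w).real (openConn a₁ a₂)ᶜ * (prodBernoulli w).real (openConn a₂ b ∩ Q)
        + d * (prodBernoulli w).real ((openConn a₁ a₂)ᶜ ∩ Q) := by
  rcases eq_or_ne a₁ a₂ with h12 | h12
  · subst h12
    have h0 : (prodBernoulli w).real ((openConn a₁ a₁)ᶜ : Set (BondConfig (Fin n))) = 0 := by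
      have : ((openConn a₁ a₁)ᶜ : Set (BondConfig (Fin n))) = ∅ :=
        Set.eq_empty_of_forall_notMem fun ω hω => hω (SimpleGraph.Reachable.refl a₁)
      rw [this, measureReal_empty]
    rw [h0]
    simp only [zero_mul, zero_add]
    exact mul_nonneg hd measureReal_nonneg
  have hDm : MeasurableSet ((openConn a₁ a₂)ᶜ : Set (BondConfig (Fin n))) := MeasurableSet.of_discrete
  have hagree : ∀ E : Set (BondConfig (Fin n)),
      (openConn a₁ b ∩ E) \ (openConn a₁ a₂)ᶜ = (openConn a₂ b ∩ E) \ (openConn a₁ a₂)ᶜ := by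
    intro E
    ext ω
    simp only [Set.mem_sdiff, Set.mem_inter_iff, Set.mem_compl_iff, not_not]
    constructor
    · rintro ⟨⟨h1, hE⟩, h2⟩
      exact ⟨⟨SimpleGraph.Reachable.trans (SimpleGraph.Reachable.symm h2) h1, hE⟩, h2⟩
    · rintro ⟨⟨h1, hE⟩, h2⟩
      exact ⟨⟨SimpleGraph.Reachable.trans h2 h1, hE⟩, h2⟩
  have hs1 := measureReal_inter_add_sdiff (μ := prodBernoulli w) (s := openConn a₁ b) hDm
  have hs2 := measureReal_inter_add_sdiff (μ := prodBernoulli w) (s := openConn a₂ b) hDm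
  have hs1Q := measureReal_inter_add_sdiff (μ := prodBernoulli w) (s := openConn a₁ b ∩ Q) hDm
  have hs2Q := measureReal_inter_add_sdiff (μ := prodBernoulli w) (s := openConn a₂ b ∩ Q) hDm
  have he : (prodBernoulli w).real (openConn a₁ b \ (openConn a₁ a₂)ᶜ) =
      (prodBernoulli w).real (openConn a₂ b \ (openConn a₁ a₂)ᶜ) := by
    have h := hagree Set.univ
    simp only [Set.inter_univ] at h
    rw [h]
  have heQ : (prodBernoulli w).real ((openConn a₁ b ∩ Q) \ (openConn a₁ a₂)ᶜ) =
      (prodBernoulli w).real ((openConn a₂ b ∩ Q) \ (openConn a₁ a₂)ᶜ) := by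
    rw [hagree Q]
  rw [Set.inter_comm (openConn a₁ b) (openConn a₁ a₂)ᶜ] at hs1
  rw [Set.inter_comm (openConn a₂ b) (openConn a₁ a₂)ᶜ] at hs2
  rw [Set.inter_comm (openConn a₁ b ∩ Q) (openConn a₁ a₂)ᶜ] at hs1Q
  rw [Set.inter_comm (openConn a₂ b ∩ Q) (openConn a₁ a₂)ᶜ] at hs2Q
  have hI := knLemma3i_oneCluster w a₂ a₁ b Q hQ h12.symm
  have hcomm : (openConn a₂ a₁ : Set (BondConfig (Fin n))) = openConn a₁ a₂ :=
    Set.ext fun _ => ⟨fun h => SimpleGraph.Reachable.symm h, fun h => SimpleGraph.Reachable.symm h⟩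
  rw [hcomm] at hI
  have hII := knLemma3i_twoCluster w a₁ a₂ b Q hQ h12
  have hx : (prodBernoulli w).real ((openConn a₁ a₂)ᶜ ∩ openConn a₁ b) ≤
      (prodBernoulli w).real ((openConn a₁ a₂)ᶜ ∩ openConn a₂ b) + d := by
    linarith
  have hN0 : 0 ≤ (prodBernoulli w).real ((openConn a₁ a₂)ᶜ : Set (BondConfig (Fin n))) := measureReal_nonneg
  have hNQ0 : 0 ≤ (prodBernoulli w).real ((openConn a₁ a₂)ᶜ ∩ Q) := measureReal_nonneg
  -- the conditional chain on `N`
  have hchain : (prodBernoulli w).real (openConn a₁ a₂)ᶜ *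
      (prodBernoulli w).real ((openConn a₁ a₂)ᶜ ∩ (openConn a₁ b ∩ Q)) ≤
      (prodBernoulli w).real (openConn a₁ a₂)ᶜ *
        (prodBernoulli w).real ((openConn a₁ a₂)ᶜ ∩ (openConn a₂ b ∩ Q))
        + d * (prodBernoulli w).real ((openConn a₁ a₂)ᶜ ∩ Q) :=
    calc (prodBernoulli w).real (openConn a₁ a₂)ᶜ *
          (prodBernoulli w).real ((openConn a₁ a₂)ᶜ ∩ (openConn a₁ b ∩ Q))
        ≤ (prodBernoulli w).real ((openConn a₁ a₂)ᶜ ∩ openConn a₁ b) *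
          (prodBernoulli w).real ((openConn a₁ a₂)ᶜ ∩ Q) := hII
      _ ≤ ((prodBernoulli w).real ((openConn a₁ a₂)ᶜ ∩ openConn a₂ b) + d) *
          (prodBernoulli w).real ((openConn a₁ a₂)ᶜ ∩ Q) := mul_le_mul_of_nonneg_right hx hNQ0
      _ = (prodBernoulli w).real ((openConn a₁ a₂)ᶜ ∩ openConn a₂ b) *
            (prodBernoulli w).real ((openConn a₁ a₂)ᶜ ∩ Q) +
          d * (prodBernoulli w).real ((openConn a₁ a₂)ᶜ ∩ Q) := add_mul _ _ _
      _ ≤ (prodBernoulli w).real (openConn a₁ a₂)ᶜ *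
            (prodBernoulli w).real ((openConn a₁ a₂)ᶜ ∩ (openConn a₂ b ∩ Q)) +
          d * (prodBernoulli w).real ((openConn a₁ a₂)ᶜ ∩ Q) := by
        have := hI
        linarith
  -- off `N` the two events agree
  rw [← hs1Q, ← hs2Q, heQ]
  nlinarith [hchain, hN0]

/-- **Quantitative Kozma–Nitzan Lemma 5 (block form, any relay, bad vertices allowed).**  Let `v ∈ S ∌ b`, `a` any vertex and
`g = glue w S` (weight `1` on the non-loop pairs inside `S`).  Then
`μ_w(a ↮ v) · μ_g(a ↔ b) ≤ μ_w(a ↮ v) · μ_g(v ↔ b) + (μ_w(a ↔ b) − μ_w(v ↔ b))⁺ · μ_g(a ↮ v)`.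
For `μ_w(a ↔ b) ≤ μ_w(v ↔ b)` this is `stub_gluingLemma5` (multiplied by `μ_w(a ↮ v)`); in general the additive error is the badness gap of `v`
below `a` scaled by `μ_g(a ↮ v)/μ_w(a ↮ v) = μ_w(a ↮ S)/μ_w(a ↮ v) ≤ 1`. [cite: KozmaNitzan2024, §3.2 Lemma 5 (p. 13), Lemma 3(i) (pp. 6–7)] -/
theorem gluingLemma5_quant (n : ℕ) (w : Sym2 (Fin n) → unitInterval) (S : Finset (Fin n)) (a v b : Fin n)
    (hvS : v ∈ S) (hbS : b ∉ S) :
    (prodBernoulli w).real (openConn a v)ᶜ *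
        (prodBernoulli (fun e : Sym2 (Fin n) => if (∀ x ∈ e, x ∈ S) ∧ ¬ e.IsDiag then 1 else w e)).real (openConn a b) ≤
      (prodBernoulli w).real (openConn a v)ᶜ *
        (prodBernoulli (fun e : Sym2 (Fin n) => if (∀ x ∈ e, x ∈ S) ∧ ¬ e.IsDiag then 1 else w e)).real (openConn v b)
      + max ((prodBernoulli w).real (openConn a b) - (prodBernoulli w).real (openConn v b)) 0 *
        (prodBernoulli (fun e : Sym2 (Fin n) => if (∀ x ∈ e, x ∈ S) ∧ ¬ e.IsDiag then 1 else w e)).real (openConn a v)ᶜ := by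
  have _hb := hbS
  set g : Sym2 (Fin n) → unitInterval :=
    fun e => if (∀ x ∈ e, x ∈ S) ∧ ¬ e.IsDiag then 1 else w e with hg
  set δ : ℝ := max ((prodBernoulli w).real (openConn a b) - (prodBernoulli w).real (openConn v b)) 0 with hδ
  have hδ0 : 0 ≤ δ := le_max_right _ _
  have hδle : (prodBernoulli w).real (openConn a b) ≤ (prodBernoulli w).real (openConn v b) + δ := by
    have := le_max_left ((prodBernoulli w).real (openConn a b) - (prodBernoulli w).real (openConn v b)) 0
    linarith
  -- `D` = non-loop pairs inside `S`, `E` = all of them open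
  set D : Finset (Sym2 (Fin n)) :=
    Finset.univ.filter (fun e => (∀ x ∈ e, x ∈ S) ∧ ¬ e.IsDiag) with hDdef
  have hD : ∀ e, e ∈ D ↔ (∀ x ∈ e, x ∈ S) ∧ ¬ e.IsDiag := fun e => by simp [hDdef]
  set E : Set (BondConfig (Fin n)) := {ω | (↑D : Set (Sym2 (Fin n))) ⊆ ω} with hEdef
  -- the sprinkled weights
  set u : unitInterval → Sym2 (Fin n) → unitInterval :=
    fun ε e => if e ∈ D then Set.Icc.convexComb (w e) 1 ε else w e with hu
  have hwu : ∀ ε, w ≤ u ε := by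
    intro ε e
    by_cases he : e ∈ D
    · simp only [hu, he, if_true]
      exact Set.Icc.le_convexComb unitInterval.le_one' ε
    · simp only [hu, he, if_false]
      exact le_rfl
  have hu0 : u 0 = w := by
    funext e
    by_cases he : e ∈ D
    · simp only [hu, he, if_true, Set.Icc.convexComb_zero]
    · simp only [hu, he, if_false]
  have hucont : Continuous u := by
    refine continuous_pi fun e => ?_
    by_cases he : e ∈ D
    · simp only [hu, he, if_true]
      exact Set.Icc.continuous_convexComb (w e) 1
    · simp only [hu, he, if_false]
      exact continuous_const
  have hpin : ∀ ε, (fun e => if e ∈ D then (1 : unitInterval) else u ε e) = g := by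
    intro ε
    funext e
    by_cases he : e ∈ D
    · simp only [hg, he, if_true, if_pos ((hD e).1 he)]
    · have he' : ¬ ((∀ x ∈ e, x ∈ S) ∧ ¬ e.IsDiag) := fun h => he ((hD e).2 h)
      simp only [hg, hu, he, if_false, if_neg he']
  have hcond : ∀ ε (X : Set (BondConfig (Fin n))),
      (prodBernoulli (u ε)).real (X ∩ E) =
        (prodBernoulli (u ε)).real E * (prodBernoulli g).real X := by
    intro ε X
    rw [hEdef, gluingLemma5_real_inter_allOpen (u ε) D MeasurableSet.of_discrete, hpin ε]
  have hpos : ∀ ε : unitInterval, 0 < (ε : ℝ) → 0 < (prodBernoulli (u ε)).real E := by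
    intro ε hε
    rw [hEdef, prodBernoulli_real_subset (u ε) D]
    refine Finset.prod_pos fun e he => ?_
    simp only [hu, he, if_true, Set.Icc.coe_convexComb, Set.Icc.coe_one, mul_one]
    exact add_pos_of_nonneg_of_pos
      (mul_nonneg (unitInterval.one_minus_nonneg ε) (unitInterval.nonneg (w e))) hε
  -- the step at fixed `ε > 0`
  have hstep : ∀ ε : unitInterval, 0 < (ε : ℝ) →
      (prodBernoulli (u ε)).real (openConn a v)ᶜ * (prodBernoulli g).real (openConn a b) ≤
        (prodBernoulli (u ε)).real (openConn a v)ᶜ * (prodBernoulli g).real (openConn v b)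
        + (δ + ((prodBernoulli (u ε)).real (openConn a b) - (prodBernoulli w).real (openConn a b)))
          * (prodBernoulli g).real (openConn a v)ᶜ := by
    intro ε hε
    have hma : (prodBernoulli w).real (openConn a b) ≤ (prodBernoulli (u ε)).real (openConn a b) :=
      prodBernoulli_real_mono_of_isUpperSet (hwu ε) (isUpperSet_openConn a b) MeasurableSet.of_discrete
    have hmv : (prodBernoulli w).real (openConn v b) ≤ (prodBernoulli (u ε)).real (openConn v b) :=
      prodBernoulli_real_mono_of_isUpperSet (hwu ε) (isUpperSet_openConn v b) MeasurableSet.of_discrete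
    have h3 := knLemma3i_sharp (u ε) a v b E
      (δ + ((prodBernoulli (u ε)).real (openConn a b) - (prodBernoulli w).real (openConn a b)))
      (gluingLemma5_allOpen_mono hD hvS) (add_nonneg hδ0 (sub_nonneg.2 hma)) (by linarith)
    rw [hcond ε (openConn a b), hcond ε (openConn v b), hcond ε ((openConn a v)ᶜ)] at h3
    have hE := hpos ε hε
    have key : (prodBernoulli (u ε)).real E *
        ((prodBernoulli (u ε)).real (openConn a v)ᶜ * (prodBernoulli g).real (openConn a b)) ≤
      (prodBernoulli (u ε)).real E *
        ((prodBernoulli (u ε)).real (openConn a v)ᶜ * (prodBernoulli g).real (openConn v b)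
          + (δ + ((prodBernoulli (u ε)).real (openConn a b) - (prodBernoulli w).real (openConn a b)))
            * (prodBernoulli g).real (openConn a v)ᶜ) := by
      nlinarith [h3]
    exact le_of_mul_le_mul_left key hE
  -- `ε → 0`
  obtain ⟨ε, hεpos, hεlim⟩ := gluingLemma5_exists_seq_tendsto_zero
  have hFab : Continuous fun t : unitInterval => (prodBernoulli (u t)).real (openConn a b) :=
    (stub_weightContinuity n (openConn a b)).comp hucont
  have hFN : Continuous fun t : unitInterval => (prodBernoulli (u t)).real ((openConn a v)ᶜ) :=
    (stub_weightContinuity n ((openConn a v)ᶜ)).comp hucont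
  have hlimL : Tendsto (fun k => (prodBernoulli (u (ε k))).real (openConn a v)ᶜ * (prodBernoulli g).real (openConn a b))
      atTop (𝓝 ((prodBernoulli (u 0)).real (openConn a v)ᶜ * (prodBernoulli g).real (openConn a b))) :=
    ((hFN.tendsto 0).comp hεlim).mul tendsto_const_nhds
  have hlimR : Tendsto (fun k => (prodBernoulli (u (ε k))).real (openConn a v)ᶜ * (prodBernoulli g).real (openConn v b)
        + (δ + ((prodBernoulli (u (ε k))).real (openConn a b) - (prodBernoulli w).real (openConn a b)))
          * (prodBernoulli g).real (openConn a v)ᶜ)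
      atTop (𝓝 ((prodBernoulli (u 0)).real (openConn a v)ᶜ * (prodBernoulli g).real (openConn v b)
        + (δ + ((prodBernoulli (u 0)).real (openConn a b) - (prodBernoulli w).real (openConn a b)))
          * (prodBernoulli g).real (openConn a v)ᶜ)) :=
    (((hFN.tendsto 0).comp hεlim).mul tendsto_const_nhds).add
      ((tendsto_const_nhds.add (((hFab.tendsto 0).comp hεlim).sub tendsto_const_nhds)).mul tendsto_const_nhds)
  rw [hu0] at hlimL hlimR
  rw [sub_self, add_zero] at hlimR
  exact le_of_tendsto_of_tendsto' hlimL hlimR fun k => hstep (ε k) (hεpos k)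

end QuantLemma5

open Filter Topology Literature.Probability.LatticeModels Literature.Probability.Percolation in
/-- Registered helper stub `stub_knLemma3iSharp_xfa` (invested seat xfam-a) = `knLemma3i_sharp`. [cite: KozmaNitzan2024, Lemma 3(i) (pp. 6–7)] -/
theorem stub_knLemma3iSharp_xfa : ∀ (n : ℕ) (w : Sym2 (Fin n) → unitInterval) (a₁ a₂ b : Fin n) (Q : Set (BondConfig (Fin n))) (d : ℝ), (∀ ω ω', ω ∈ Q → openEdgeCluster ω a₂ ⊆ openEdgeCluster ω' a₂ → ω' ∈ Q) → 0 ≤ d → (prodBernoulli w).real (openConn a₁ b) ≤ (prodBernoulli w).real (openConn a₂ b) + d → (prodBernoulli w).real (openConn a₁ a₂)ᶜ * (prodBernoulli w).real (openConn a₁ b ∩ Q) ≤ (prodBernoulli w).real (openConn a₁ a₂)ᶜ * (prodBernoulli w).real (openConn a₂ b ∩ Q) + d * (prodBernoulli w).real ((openConn a₁ a₂)ᶜ ∩ Q) :=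
  fun _ w a₁ a₂ b Q d hQ hd hle => knLemma3i_sharp w a₁ a₂ b Q d hQ hd hle

open Filter Topology Literature.Probability.LatticeModels Literature.Probability.Percolation in
/-- Registered helper stub `stub_gluingLemma5Quant_xfa` (invested seat xfam-a) = `gluingLemma5_quant` (quantitative KN Lemma 5, block form).
[cite: KozmaNitzan2024, §3.2 Lemma 5 (p. 13)] -/
theorem stub_gluingLemma5Quant_xfa : ∀ (n : ℕ) (w : Sym2 (Fin n) → unitInterval) (S : Finset (Fin n)) (a v b : Fin n), v ∈ S → b ∉ S → (prodBernoulli w).real (openConn a v)ᶜ * (prodBernoulli (fun e : Sym2 (Fin n) => if (∀ x ∈ e, x ∈ S) ∧ ¬ e.IsDiag then 1 else w e)).real (openConn a b) ≤ (prodBernoulli w).real (openConn a v)ᶜ * (prodBernoulli (fun e : Sym2 (Fin n) => if (∀ x ∈ e, x ∈ S) ∧ ¬ e.IsDiag then 1 else w e)).real (openConn v b) + max ((prodBernoulli w).real (openConn a b) - (prodBernoulli w).real (openConn v b)) 0 * (prodBernoulli (fun e : Sym2 (Fin n) => if (∀ x ∈ e, x ∈ S) ∧ ¬ e.IsDiag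 then 1 else w e)).real (openConn a v)ᶜ :=
  fun n w S a v b hvS hbS => gluingLemma5_quant n w S a v b hvS hbS

end

end Summit.CriticalPhenomena.PercolationContinuityZ3.Theorems
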